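import Literature.Probability.Percolation.IkhlefPonsaingFirstPassageVertex
import Summits.CriticalPhenomena.CardyFormulaZ2.Theorems.CardySusyWardParafermionFamiliesToSLESixOfEnvelope

/-!
# Line `strip-anchored-vertex-normalisation` (crux stmt-CriticalPhenomena-10814), skeleton r5: the strip law is a
# THEOREM — the anchor first moment is unconditionally of order `δ^{-5/3}`, and the crux holds modulo the uniform
# inner envelope alone

Crux `CardySusyWard.ParafermionFamiliesToSLESix` (stmt-CriticalPhenomena-10814), line `strip-anchored-vertex-normalisation`
(leads c0–c4).  Skeleton r4 (lead c2/c3) had exactly two open registered stubs: `stub_uniformInnerEnvelope` (UIE, shared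
by name with crux stmt-CriticalPhenomena-11387) and `stub_ikhlefPonsaingFirstPassage`, the Literature named fact
`Literature.Probability.Percolation.IkhlefPonsaingFirstPassage` (Ikhlef–Ponsaing 2012, Prop. 4.7: the exact first-site
passage law `P_b(2m+1) = A_V(2m+1) A_V(2m+3) / N_8(2m+2)²` of the percolation strip).  Since 2026-08-17 that fact is
DISCHARGED in the tree (`Literature.Probability.Percolation.IkhlefPonsaingFirstPassage_holds`,
`Literature/Probability/Percolation/IkhlefPonsaingFirstPassageVertex.lean`: the degree-`4m` polynomial solution of IP12's
boundary `q`KZ system supplied from the spin-chain side and the vertex uniqueness theorem).  This file (lead c4):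

* discharges the registered stub `stub_ikhlefPonsaingFirstPassage` BY NAME;
* records the now UNCONDITIONAL consequences of the line's landed chain: the boundary first moment of the concrete anchor
  family of the diagonal square has norm `≥ c δ^{-5/3}` (`anchorMoment_lower`, from `stub_anchorMoment_of_IP`, p136941), hence —
  by the moment identity `2cos(π/12)·Σ_{S_max} F_δ = Σ_wall G − 2(1−i)·Σ_wall conj(ẑ) coeff G` (`stub_momentIdentity`,
  p131967) — the TOTAL spin-`1/3` vertex observable `Σ_{p ∈ S_max} F_δ(p)` (the expected phase sum `Σ_k e^{-iW_k/3}` along the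
  whole exploration curve over the random both-faces-inner medial vertices) has norm `≥ c' δ^{-5/3}` eventually in `δ`
  (`totalVertexSum_lower`): an unconditional SHARP-exponent lower bound for critical bond percolation on `ℤ²`;
* gives the line's closing form with ONE hypothesis: `UniformInnerEnvelope → ¬ParafermionPrecompact`,
  `UniformInnerEnvelope → ParafermionBulkNondegenerate` (Duminil-Copin–Smirnov 2012, Conj. 8.7's non-degeneracy at `q = 1`,
  `[status: open]`), `UniformInnerEnvelope → ParafermionFamiliesToSLESix` (the crux AS TYPED).

So the crux (as typed `= H ∨ SLE₆(ℤ²)`, Disproof.lean §5) is now EXACTLY the envelope bet: the only open registered stub of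
skeleton r5 is the layer estimate that `UniformInnerEnvelope` supplies (`stub_totalSmall_of_UIE`, p131326).

References: Y. Ikhlef, A. K. Ponsaing, J. Stat. Phys. 149 (2012) 10–36, Prop. 4.7; H. Duminil-Copin, S. Smirnov,
*Conformal invariance of lattice models* (2012), §8, Conj. 8.7.
-/

noncomputable section

namespace Summit.CriticalPhenomena.CardyFormulaZ2.Theorems.ParafermionFamiliesToSLESix.StripAnchored

open MeasureTheory Filter Set Metric
open scoped Topology
open Literature.Probability.LatticeModels (DiscreteDobrushin ParafermionBulkNondegenerate)
open Literature.Probability.RandomPlanarGeometry (DobrushinDomain)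
open Summit.CriticalPhenomena.CardyFormulaZ2.Theses.CardySusyWard
open Summit.CriticalPhenomena.CardyFormulaZ2.Theorems.ParafermionPrecompact.Negative (IsFamily
  parafermionPrecompact_iff_vanishing parafermionPrecompact_iff_not_bulkNondegenerate)
open Summit.CriticalPhenomena.CardyFormulaZ2.Cruxes.EdgePrecompact.QkzStripBoundaryArm (UniformInnerEnvelope)
open S5 (anchorDomain)

/-- **Registered stub `stub_ikhlefPonsaingFirstPassage` of the line `strip-anchored-vertex-normalisation` — DISCHARGED**:
Ikhlef–Ponsaing's first-site passage law of the percolation strip is the tree's theorem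
`Literature.Probability.Percolation.IkhlefPonsaingFirstPassage_holds`. [cite: IkhlefPonsaing2012, Prop. 4.7] -/
theorem stub_ikhlefPonsaingFirstPassage : Literature.Probability.Percolation.IkhlefPonsaingFirstPassage :=
  Literature.Probability.Percolation.IkhlefPonsaingFirstPassage_holds

/-- **The anchor first moment is of order `δ^{-5/3}`, unconditionally**: for the concrete admissible family of the
diagonal anchor square, eventually in `δ`, `c δ^{-5/3} ≤ ‖Σ_wall G − 2(1−i)·Σ_wall conj(ẑ) coeff G‖`
(`stub_anchorMoment_of_IP` fed with the discharged strip law). [folklore] -/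
theorem anchorMoment_lower : ∃ Λ : ℝ → DiscreteDobrushin, IsFamily anchorDomain Λ ∧ ∃ c : ℝ, 0 < c ∧
    ∀ᶠ δ in 𝓝[>] (0:ℝ), c * δ ^ (-(5:ℝ) / 3) ≤ ‖wallPlainSum (Λ δ) δ - 2 * (1 - Complex.I) * momentSum (Λ δ) δ‖ :=
  stub_anchorMoment_of_IP stub_ikhlefPonsaingFirstPassage

/-- **The total spin-`1/3` vertex observable of the anchor family is of order at least `δ^{-5/3}`, unconditionally**:
for the concrete admissible family `Λ` of the diagonal anchor square there is `c > 0` with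
`c δ^{-5/3} ≤ ‖totalVertexSum (Λ δ) δ‖ = ‖Σ_{p ∈ S_max} F_δ(p)‖` eventually in `δ` — the moment identity
(`stub_momentIdentity`) divides the anchor bound by `2cos(π/12)`. In words: the expected sum of the phases
`e^{-iW/3}` over all passages of the critical bond-percolation exploration path through random both-faces-inner medial
vertices of the anchor square at mesh `δ` has modulus `≥ c δ^{-5/3}`. [folklore] -/
theorem totalVertexSum_lower : ∃ Λ : ℝ → DiscreteDobrushin, IsFamily anchorDomain Λ ∧ ∃ c : ℝ, 0 < c ∧
    ∀ᶠ δ in 𝓝[>] (0:ℝ), c * δ ^ (-(5:ℝ) / 3) ≤ ‖totalVertexSum (Λ δ) δ‖ := by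
  obtain ⟨Λ, hΛ, c, hc, hbig⟩ := anchorMoment_lower
  set A : ℝ := 2 * Real.cos (Real.pi / 12) with hA
  have hA0 : 0 < A := by
    have : 0 < Real.cos (Real.pi / 12) :=
      Real.cos_pos_of_mem_Ioo ⟨by linarith [Real.pi_pos], by linarith [Real.pi_pos]⟩
    positivity
  refine ⟨Λ, hΛ, c / A, by positivity, ?_⟩
  filter_upwards [stub_momentIdentity anchorDomain Λ hΛ, hbig] with δ hid hge
  have key : c * δ ^ (-(5:ℝ) / 3) ≤ A * ‖totalVertexSum (Λ δ) δ‖ := by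
    calc c * δ ^ (-(5:ℝ) / 3) ≤ ‖wallPlainSum (Λ δ) δ - 2 * (1 - Complex.I) * momentSum (Λ δ) δ‖ := hge
      _ = ‖((A : ℝ) : ℂ) * totalVertexSum (Λ δ) δ‖ := by rw [← hid]
      _ = A * ‖totalVertexSum (Λ δ) δ‖ := by rw [norm_mul, Complex.norm_real, Real.norm_of_nonneg hA0.le]
  calc c / A * δ ^ (-(5:ℝ) / 3) = c * δ ^ (-(5:ℝ) / 3) / A := by ring
    _ ≤ A * ‖totalVertexSum (Λ δ) δ‖ / A := div_le_div_of_nonneg_right key hA0.le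
    _ = ‖totalVertexSum (Λ δ) δ‖ := by field_simp

/-- **The typed hypothesis `ParafermionPrecompact` contradicts the uniform inner envelope** (the strip law being a
theorem): `false_of_envelope_of_IP_of_parafermionPrecompact` with its second argument discharged. [folklore] -/
theorem false_of_envelope_of_parafermionPrecompact (hUB : UniformInnerEnvelope) (hP : ParafermionPrecompact) : False :=
  false_of_envelope_of_IP_of_parafermionPrecompact hUB stub_ikhlefPonsaingFirstPassage hP

/-- **Under the uniform inner envelope the typed second hypothesis of the crux is FALSE** (it is the vanishing
normalisation, `parafermionPrecompact_iff_vanishing`, and vanishing contradicts the anchor first moment). [folklore] -/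
theorem not_parafermionPrecompact_of_envelope (hUB : UniformInnerEnvelope) : ¬ ParafermionPrecompact :=
  fun hP => false_of_envelope_of_parafermionPrecompact hUB hP

/-- **Bulk non-degeneracy of the spin-`1/3` parafermion of bond percolation on `ℤ²` from the uniform inner envelope
ALONE** (Duminil-Copin–Smirnov 2012, Conjecture 8.7's lower bound, `ParafermionBulkNondegenerate`, `[status: open]`):
the line's deliverable `H` modulo its single remaining bet. [cite: DuminilCopinSmirnov2012Lattice, Conjecture 8.7] -/
theorem bulkNondegenerate_of_envelope : UniformInnerEnvelope → ParafermionBulkNondegenerate :=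
  fun hUB => bulkNondegenerate_of_envelope_of_IP hUB stub_ikhlefPonsaingFirstPassage

/-- **The crux `ParafermionFamiliesToSLESix` (stmt-CriticalPhenomena-10814) AS TYPED, modulo the uniform inner envelope
alone**: its second hypothesis is contradictory under the envelope, so the implication holds. [folklore] -/
theorem parafermionFamiliesToSLESix_of_envelope : UniformInnerEnvelope → ParafermionFamiliesToSLESix :=
  fun hUB => parafermionFamiliesToSLESix_of_envelope_of_IP hUB stub_ikhlefPonsaingFirstPassage

end Summit.CriticalPhenomena.CardyFormulaZ2.Theorems.ParafermionFamiliesToSLESix.StripAnchored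

end
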